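import Summits.AnomalousDissipation.AnomalousDissipation.Theses.MomentParity
import Summits.AnomalousDissipation.AnomalousDissipation.Theorems.CubicParityLoud.Negative.Clauses

/-!
# `MomentParity.LadderGlue3` (stmt-AnomalousDissipation-14841): proof

`Summit.AnomalousDissipation.AnomalousDissipation.Theses.MomentParity.LadderGlue3` —
the glue of the `d = 3` rung into the cone of `closes` of route MomentParity:
`CubicParityLoud → CubicClimb → QuarticGate`.

Pure logic: instantiate `CubicParityLoud` at the shear (Kolmogorov) force
`shearForce = cos(2πx₁) e₂` (smooth, divergence-free, mean-zero, non-zero — the four force lemmas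
of `Theorems/CubicParityLoud/Negative/Clauses.lean`), obtaining budgets `E, ε` and a viscosity
threshold `ν₀`; along `ν j := ν₀ / (j + 2)` (positive, `< ν₀`, `→ 0`) the conclusion
"`∀ N ≥ N₀(ν j), ∃ μ, …`" is in particular "`∃ᶠ N, ∃ μ, …`", which is the hypothesis of
`CubicClimb` verbatim; `CubicClimb` returns budgets `E', ε'` and the `QuarticGate` body; repack.
-/

-- `Summit.<Summit>.<Problem>` is the tree's mandated summit-side namespace (CONVENTIONS §2); for this
-- single-conjunct summit the two coincide, so the duplicate is deliberate.
set_option linter.dupNamespace false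

namespace Summit.AnomalousDissipation.AnomalousDissipation.Theorems

open Filter
open Summit.AnomalousDissipation.AnomalousDissipation.Theses.MomentParity
open Summit.AnomalousDissipation.AnomalousDissipation.Theorems.CubicParityLoud.Negative

/-- **Glue of the `d = 3` rung of route MomentParity** (stmt-AnomalousDissipation-14841):
`CubicParityLoud → CubicClimb → QuarticGate`, by pure logic — `CubicParityLoud` at the shear force
`cos(2πx₁) e₂` gives `E, ε, ν₀`; along the viscosities `ν j = ν₀ / (j + 2) → 0` its "eventually in
`N`" conclusion is "frequently in `N`", i.e. the hypothesis of `CubicClimb`, whose conclusion is the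
`QuarticGate` body verbatim. -/
theorem ladderGlue3_proof : LadderGlue3 := by
  unfold LadderGlue3
  intro hP hC
  obtain ⟨E, ε, ν₀, hε, hν₀, hP⟩ :=
    hP shearForce isSmooth_shearForce isDivFree_shearForce hasZeroMean_shearForce shearForce_ne_zero
  have hνpos : ∀ j : ℕ, 0 < ν₀ / ((j : ℝ) + 2) := fun j => div_pos hν₀ (by positivity)
  have hνlt : ∀ j : ℕ, ν₀ / ((j : ℝ) + 2) < ν₀ := fun j =>
    div_lt_self hν₀ (lt_add_of_nonneg_of_lt (Nat.cast_nonneg j) one_lt_two)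
  have hν0 : Tendsto (fun j : ℕ => ν₀ / ((j : ℝ) + 2)) atTop (nhds 0) :=
    tendsto_const_nhds.div_atTop (tendsto_atTop_add_const_right _ 2 tendsto_natCast_atTop_atTop)
  obtain ⟨E', ε', hε', h'⟩ := hC shearForce isSmooth_shearForce isDivFree_shearForce
    hasZeroMean_shearForce (fun j : ℕ => ν₀ / ((j : ℝ) + 2)) E ε hνpos hν0 hε fun j => by
      obtain ⟨N₀, hN₀⟩ := hP _ (hνpos j) (hνlt j)
      exact (eventually_atTop.2 ⟨N₀, hN₀⟩).frequently
  exact ⟨shearForce, isSmooth_shearForce, isDivFree_shearForce, hasZeroMean_shearForce, _, E', ε',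
    hνpos, hν0, hε', h'⟩

end Summit.AnomalousDissipation.AnomalousDissipation.Theorems
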